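import Mathlib
import Summits.Schanuel.Schanuel.Theses.RigidCore
import Literature.NumberTheory.Transcendental.ExpVarieties
import Literature.RingTheory.KrullDimension.FieldOfDefinition
import Literature.RingTheory.KrullDimension.AffineDimension
import Literature.RingTheory.NoetherNormalization.GenericLinearForms

/-!
# The slice curve over a field of constants — crux stmt-Schanuel-0969 `RigidCore.MinimalCounterexampleInAcl`

Line `kernel-arithmetic-selection` (lead prover-line-stmt-Schanuel-0969-c12-0), `--supports stmt-Schanuel-0969`;
infrastructure for the registered stub `stub_corankOne_noFullLine` (no full line of mates in corank one).

Along a full rational line of mates `u + 2πijμ` of a corank-one first failure only ONE integer coordinate `v = u_{k₀}`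
(`μ_{k₀} ≠ 0`) moves; the complementary integer coordinates `e_i = μ_{k₀} u_i − μ_i u_{k₀}` are CONSTANT along the
line.  Over the field of constants `K = ℚ(e)` the pair `(v, w)` (`w` the pure coordinate) and its exponentials have
transcendence degree `1`, so the mates of the line live on a CURVE `W ⊆ ℂ² × ℂ²` — the `K`-locus of
`P = (v, w, e^v, e^w)` — to which the rank-2 coset machinery (branch cover, window rigidity) applies.  This file is
the field-of-constants algebra:

* `kLocus[K, P]` — the `K`-locus of a point `P ∈ ℂ^σ` (common zeros of the `K`-polynomial relations of `P`), for an
  intermediate field `ℚ ≤ K ≤ ℂ`; it is Zariski closed over `ℂ` (`isZariskiClosed_kLocus`) and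
  `zariskiDim ℂ (kLocus[K, P]) ≤ trdeg_K K[P]` (`zariskiDim_kLocus_le`: the `ℂ`-closure is at most the `K`-closure,
  `Literature.RingTheory.KrullDimension.ringKrullDim_quotient_vanishingIdeal_le`, whose coordinate ring is `K[P]`,
  an affine domain of dimension `trdeg_K K[P]`), hence `≤ 1` as soon as every coordinate of `P` is algebraic over
  `K[t₀]` for one `t₀` (`zariskiDim_kLocus_le_one`);
* `mem_kLocus_adjoin_of_relations` — TRANSFER: if every `ℚ`-polynomial relation of `(e, P)` holds at `(e, P')`, then
  `P'` lies on the `ℚ(e)`-locus of `P` (clear denominators);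
* `isAlgebraic_adjoin_adjoin_of_isAlgebraic_adjoin` — base change of algebraicity from `ℚ[e, t₀]` to `ℚ(e)[t₀]`.

References: H. Matsumura, *Commutative Ring Theory*, CUP 1986, Thm 5.6 (dimension of an affine domain is its
transcendence degree); U. Görtz, T. Wedhorn, *Algebraic Geometry I*, 2nd ed. 2020, Prop. 5.38 (dimension and base
change).
-/

noncomputable section

set_option linter.dupNamespace false

open Complex Set MvPolynomial

namespace Summit.Schanuel.Schanuel.Cruxes.MinimalCounterexampleInAcl.KernelArithmeticSelection

open Literature.NumberTheory.Transcendental (IsZariskiClosed zariskiDim)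

/-! ## The `K`-locus of a point -/

/-- The `K`-LOCUS `kLocus[K, P]` of a point `P ∈ ℂ^σ` over a field of constants `K → ℂ` (local notation, no new
definition): the common zeros in `ℂ^σ` of the `K`-polynomial relations of `P`, i.e. the zero set of the prime
`ker (aeval P) ⊆ K[X_σ]`. -/
local notation3 "kLocus[" K ", " P "]" =>
  MvPolynomial.zeroLocus ℂ (RingHom.ker (MvPolynomial.aeval (R := K) (S₁ := ℂ) P))

section KLocus

variable {σ : Type} {K : Type} [Field K] [Algebra K ℂ] {P : σ → ℂ}

/-- Membership in the `K`-locus: every `K`-relation of `P` holds. [folklore] -/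
theorem mem_kLocus_iff {z : σ → ℂ} :
    z ∈ kLocus[K, P] ↔ ∀ G : MvPolynomial σ K, MvPolynomial.aeval P G = 0 → MvPolynomial.aeval z G = 0 := by
  simp only [MvPolynomial.mem_zeroLocus_iff, RingHom.mem_ker]

/-- A point lies on its own `K`-locus. [folklore] -/
theorem self_mem_kLocus : P ∈ kLocus[K, P] :=
  mem_kLocus_iff.2 fun _ h => h

/-- The `K`-locus is Zariski closed over `ℂ` (zero set of the extended ideal). [folklore] -/
theorem isZariskiClosed_kLocus : IsZariskiClosed ℂ (kLocus[K, P]) :=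
  ⟨(RingHom.ker (MvPolynomial.aeval P : MvPolynomial σ K →ₐ[K] ℂ)).map (MvPolynomial.map (algebraMap K ℂ)),
    (Literature.RingTheory.KrullDimension.zeroLocus_map _).symm⟩

/-- The `K`-polynomials vanishing on the `K`-locus of `P` are exactly the `K`-relations of `P`. [folklore] -/
theorem vanishingIdeal_kLocus :
    MvPolynomial.vanishingIdeal K (kLocus[K, P]) =
      RingHom.ker (MvPolynomial.aeval P : MvPolynomial σ K →ₐ[K] ℂ) := by
  refine le_antisymm ?_ (MvPolynomial.le_vanishingIdeal_zeroLocus _)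
  intro G hG
  rw [MvPolynomial.mem_vanishingIdeal_iff] at hG
  exact hG P self_mem_kLocus

variable [Fintype σ]

/-- **The dimension of the `K`-locus of `P` is at most `trdeg_K K[P]`**: the `ℂ`-closure of a set is at most its
`K`-closure (`ringKrullDim_quotient_vanishingIdeal_le`), whose coordinate ring `K[X] ⧸ ker (aeval P) ≅ K[P]` is an
affine domain of Krull dimension `trdeg_K K[P]` (Matsumura, Thm 5.6). [cite: Matsumura1987, Thm 5.6] -/
theorem zariskiDim_kLocus_le :
    zariskiDim ℂ (kLocus[K, P]) ≤
      (Cardinal.toNat (Algebra.trdeg K (Algebra.adjoin K (Set.range P))) : WithBot ℕ∞) := by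
  classical
  set I : Ideal (MvPolynomial σ K) := RingHom.ker (MvPolynomial.aeval P : MvPolynomial σ K →ₐ[K] ℂ) with hI
  haveI : I.IsPrime := RingHom.ker_isPrime _
  haveI : IsDomain (MvPolynomial σ K ⧸ I) := Ideal.Quotient.isDomain I
  haveI : Algebra.FiniteType K (MvPolynomial σ K ⧸ I) :=
    Algebra.FiniteType.of_surjective (Ideal.Quotient.mkₐ K I) (Ideal.Quotient.mkₐ_surjective K I)
  have h1 : zariskiDim ℂ (kLocus[K, P]) ≤ ringKrullDim (MvPolynomial σ K ⧸ I) := by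
    have h := Literature.RingTheory.KrullDimension.ringKrullDim_quotient_vanishingIdeal_le (k := K) (kLocus[K, P])
    rw [vanishingIdeal_kLocus] at h
    exact h
  -- `K[X] ⧸ I ≃ₐ[K] K[P]`
  let g₀ : MvPolynomial σ K →ₐ[K] Algebra.adjoin K (Set.range P) :=
    (MvPolynomial.aeval P).codRestrict (Algebra.adjoin K (Set.range P)) fun f => by
      rw [Algebra.adjoin_range_eq_range_aeval]; exact ⟨f, rfl⟩
  have hg₀ : Function.Surjective g₀ := by
    rintro ⟨y, hy⟩
    rw [Algebra.adjoin_range_eq_range_aeval] at hy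
    obtain ⟨f, rfl⟩ := hy
    exact ⟨f, rfl⟩
  have hker : RingHom.ker g₀ = I := by
    ext f
    rw [RingHom.mem_ker, hI, RingHom.mem_ker, Subtype.ext_iff]
    rfl
  have e : (MvPolynomial σ K ⧸ I) ≃ₐ[K] Algebra.adjoin K (Set.range P) :=
    (Ideal.quotientEquivAlgOfEq K hker.symm).trans (Ideal.quotientKerAlgEquivOfSurjective hg₀)
  have htr : Algebra.trdeg K (MvPolynomial σ K ⧸ I) = Algebra.trdeg K (Algebra.adjoin K (Set.range P)) := by
    simpa only [Cardinal.lift_id] using e.lift_trdeg_eq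
  have h2 := Literature.RingTheory.KrullDimension.ringKrullDim_eq_trdeg K (MvPolynomial σ K ⧸ I)
  rw [h2, htr] at h1
  exact h1

/-- **The `K`-locus of a point of transcendence degree `≤ 1` over `K` is a curve**: if every coordinate of `P` is
algebraic over `K[t₀]` for one `t₀ ∈ ℂ`, then `zariskiDim ℂ (kLocus[K, P]) ≤ 1`. [cite: Matsumura1987, Thm 5.6] -/
theorem zariskiDim_kLocus_le_one (t₀ : ℂ)
    (halg : ∀ i, IsAlgebraic (Algebra.adjoin K ({t₀} : Set ℂ)) (P i)) :
    zariskiDim ℂ (kLocus[K, P]) ≤ 1 := by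
  refine (zariskiDim_kLocus_le (K := K) (P := P)).trans ?_
  have h : Algebra.trdeg K (Algebra.adjoin K (Set.range P)) ≤ Cardinal.mk ({t₀} : Set ℂ) :=
    Literature.RingTheory.NoetherNormalization.trdeg_adjoin_le_of_forall_isAlgebraic (by
      rintro _ ⟨i, rfl⟩; exact halg i)
  rw [Cardinal.mk_singleton] at h
  have h2 : Cardinal.toNat (Algebra.trdeg K (Algebra.adjoin K (Set.range P))) ≤ 1 := by
    have := Cardinal.toNat_le_toNat h (by simp)
    simpa using this
  exact_mod_cast h2

end KLocus

/-! ## Transfer of relations to the field of constants -/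

section Transfer

variable {ι σ : Type}

/-- Clearing denominators: every polynomial over `ℚ(e)` is `H(e, ·) / D(e)` with `H ∈ ℚ[E, X]`, `D ∈ ℚ[E]`,
`D(e) ≠ 0`. [folklore] -/
theorem exists_denom_of_mvPolynomial_adjoin (ev : ι → ℂ)
    (G : MvPolynomial σ (IntermediateField.adjoin ℚ (Set.range ev))) :
    ∃ (D : MvPolynomial ι ℚ) (H : MvPolynomial (ι ⊕ σ) ℚ), MvPolynomial.aeval ev D ≠ 0 ∧
      ∀ z : σ → ℂ, MvPolynomial.aeval ev D * MvPolynomial.aeval z G =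
        MvPolynomial.aeval (Sum.elim ev z) H := by
  classical
  induction G using MvPolynomial.induction_on with
  | C a =>
    obtain ⟨r, s, hrs⟩ := (IntermediateField.mem_adjoin_range_iff ℚ ev (a : ℂ)).1 a.2
    by_cases hs : MvPolynomial.aeval ev s = 0
    · refine ⟨1, 0, by simp, fun z => ?_⟩
      have ha : (a : ℂ) = 0 := by rw [hrs, hs, div_zero]
      simp only [map_one, MvPolynomial.algHom_C, map_zero, one_mul]
      show algebraMap _ ℂ a = 0
      exact ha
    · refine ⟨s, MvPolynomial.rename Sum.inl r, hs, fun z => ?_⟩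
      rw [MvPolynomial.aeval_rename, MvPolynomial.algHom_C]
      show MvPolynomial.aeval ev s * (a : ℂ) = _
      rw [hrs, mul_div_cancel₀ _ hs]
      rfl
  | add p q hp hq =>
    obtain ⟨D₁, H₁, hD₁, h₁⟩ := hp
    obtain ⟨D₂, H₂, hD₂, h₂⟩ := hq
    refine ⟨D₁ * D₂, MvPolynomial.rename Sum.inl D₂ * H₁ + MvPolynomial.rename Sum.inl D₁ * H₂,
      by rw [map_mul]; exact mul_ne_zero hD₁ hD₂, fun z => ?_⟩
    simp only [map_add, map_mul, MvPolynomial.aeval_rename]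
    rw [← h₁ z, ← h₂ z]
    have e1 : (Sum.elim ev z ∘ Sum.inl) = ev := rfl
    rw [e1]; ring
  | mul_X p i hp =>
    obtain ⟨D, H, hD, h⟩ := hp
    refine ⟨D, H * MvPolynomial.X (Sum.inr i), hD, fun z => ?_⟩
    simp only [map_mul, MvPolynomial.aeval_X, Sum.elim_inr]
    rw [← h z]; ring

/-- **TRANSFER TO THE FIELD OF CONSTANTS.**  If every `ℚ`-polynomial relation of `(e, P)` holds at `(e, P')`, then `P'`
lies on the `ℚ(e)`-locus of `P`. [folklore] -/
theorem mem_kLocus_adjoin_of_relations (ev : ι → ℂ) {P P' : σ → ℂ}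
    (h : ∀ H : MvPolynomial (ι ⊕ σ) ℚ, MvPolynomial.aeval (Sum.elim ev P) H = 0 →
      MvPolynomial.aeval (Sum.elim ev P') H = 0) :
    P' ∈ kLocus[IntermediateField.adjoin ℚ (Set.range ev), P] := by
  rw [mem_kLocus_iff]
  intro G hG
  obtain ⟨D, H, hD, hDH⟩ := exists_denom_of_mvPolynomial_adjoin ev G
  have h0 : MvPolynomial.aeval (Sum.elim ev P) H = 0 := by rw [← hDH P, hG, mul_zero]
  have h1 := hDH P'
  rw [h H h0] at h1
  exact (mul_eq_zero.1 h1).resolve_left hD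

/-- **Base change of algebraicity**: an element algebraic over `ℚ[e, t₀]` is algebraic over `ℚ(e)[t₀]`. [folklore] -/
theorem isAlgebraic_adjoin_adjoin_of_isAlgebraic_adjoin (ev : ι → ℂ) {t₀ z : ℂ}
    (h : IsAlgebraic (Algebra.adjoin ℚ (Set.range ev ∪ {t₀})) z) :
    IsAlgebraic (Algebra.adjoin (IntermediateField.adjoin ℚ (Set.range ev)) ({t₀} : Set ℂ)) z := by
  refine h.tower_top_of_subalgebra_le
    (B := (Algebra.adjoin (IntermediateField.adjoin ℚ (Set.range ev)) ({t₀} : Set ℂ)).restrictScalars ℚ) ?_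
  refine Algebra.adjoin_le ?_
  rintro y (⟨i, rfl⟩ | hy)
  · have hmem : ev i ∈ IntermediateField.adjoin ℚ (Set.range ev) := IntermediateField.subset_adjoin ℚ _ ⟨i, rfl⟩
    have h1 := Subalgebra.algebraMap_mem
      (Algebra.adjoin (IntermediateField.adjoin ℚ (Set.range ev)) ({t₀} : Set ℂ))
      (⟨ev i, hmem⟩ : IntermediateField.adjoin ℚ (Set.range ev))
    rw [Subalgebra.coe_restrictScalars, SetLike.mem_coe]
    exact h1
  · rw [Subalgebra.coe_restrictScalars, SetLike.mem_coe]
    exact Algebra.subset_adjoin hy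

end Transfer

/-! ## The slice curve -/

/-- **THE SLICE CURVE.**  If every coordinate of `P ∈ ℂ^σ` is algebraic over `ℚ[e, t₀]`, there is a Zariski closed
`W ⊆ ℂ^σ` of dimension `< 2` (the `ℚ(e)`-locus of `P`) containing every point `P'` at which all `ℚ`-polynomial
relations of `(e, P)` hold. [cite: Matsumura1987, Thm 5.6] -/
theorem exists_sliceCurve {ι σ : Type} [Fintype σ] (ev : ι → ℂ) (P : σ → ℂ) (t₀ : ℂ)
    (halg : ∀ i, IsAlgebraic (Algebra.adjoin ℚ (Set.range ev ∪ {t₀})) (P i)) :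
    ∃ W : Set (σ → ℂ), IsZariskiClosed ℂ W ∧ zariskiDim ℂ W < 2 ∧
      ∀ P' : σ → ℂ, (∀ H : MvPolynomial (ι ⊕ σ) ℚ, MvPolynomial.aeval (Sum.elim ev P) H = 0 →
        MvPolynomial.aeval (Sum.elim ev P') H = 0) → P' ∈ W :=
  ⟨kLocus[IntermediateField.adjoin ℚ (Set.range ev), P], isZariskiClosed_kLocus,
    lt_of_le_of_lt (zariskiDim_kLocus_le_one t₀ fun i => isAlgebraic_adjoin_adjoin_of_isAlgebraic_adjoin ev (halg i))
      (by decide),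
    fun _ h => mem_kLocus_adjoin_of_relations ev h⟩

/-- **Registered helper `stub_noFullLineSlice` (PROVED)** — explicit-binder form of `exists_sliceCurve` on `ℂ² × ℂ²` (helper
for `stub_corankOne_noFullLine`). [cite: Matsumura1987, Thm 5.6] -/
theorem stub_noFullLineSlice : ∀ (ι : Type) (ev : ι → ℂ) (P : Fin 2 ⊕ Fin 2 → ℂ) (t₀ : ℂ), (∀ i, IsAlgebraic ↥(Algebra.adjoin ℚ (Set.range ev ∪ {t₀})) (P i)) → ∃ W : Set (Fin 2 ⊕ Fin 2 → ℂ), Literature.NumberTheory.Transcendental.IsZariskiClosed ℂ W ∧ Literature.NumberTheory.Transcendental.zariskiDim ℂ W < 2 ∧ ∀ P' : Fin 2 ⊕ Fin 2 → ℂ, (∀ H : MvPolynomial (ι ⊕ (Fin 2 ⊕ Fin 2)) ℚ, MvPolynomial.aeval (Sum.elim ev P) H = 0 → MvPolynomial.aeval (Sum.elim ev P') H = 0) → P' ∈ W :=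
  fun _ ev P t₀ halg => exists_sliceCurve ev P t₀ halg

end Summit.Schanuel.Schanuel.Cruxes.MinimalCounterexampleInAcl.KernelArithmeticSelection

end
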